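import Literature.Topology.FourManifolds.PlumbingFunction
import Literature.Topology.FourManifolds.SphereProductCohomology
import Literature.Topology.FourManifolds.NullCobordismHCobordism
import Literature.AlgebraicTopology.SingularHomology.MayerVietorisIsoRight
import Literature.AlgebraicTopology.SingularHomology.SphereHomology
import HarnessLib

/-!
# The homology of the `E₈` plumbing: `M(4m) ≃ ⋁₈ S²ᵐ`

Topic `Literature/Topology/FourManifolds`; fourth file of the construction of Kosinski's `M(4m)`
(A. Kosinski, *Differential Manifolds* (1993), VI.12), fact seat of
`Literature.Topology.FourManifolds.HomotopySphere.exists_intersectionForm_equivalent_e8Form`.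
Kosinski VI.(11.5): a `(2k, k)`-handlebody of genus `r` "has the homotopy type of a wedge of `r`
`k`-spheres"; for the plumbing this is read off directly: each tube deformation retracts onto its
core sphere by shrinking the fibres (the size function `ρ` is monotone along the shrinking), two
plumbed tubes meet in a contractible plumbing square, and Mayer–Vietoris along the `E₈` tree gives
`Hⱼ(M(4m); ℤ) = 0` for `0 < j ≠ k` and `H_k(M(4m); ℤ) ≅ ℤ⁸`.

* `Plumbing.shrink` — the fibre-shrinking homotopy `(p, q) ↦ (p, ((1 - t) q + t p)/‖…‖)` of
  `Sᵏ × Sᵏ` off the antidiagonal; it does not decrease `⟪p, q⟫`, so it preserves the tubes, the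
  plumbing domains and the sublevel sets of the size functions (`rhoHat_shrink_le`);
* `Plumbing.pieceT v ε = {ρ̂ᵥ < ε} ⊆ N` is homotopy equivalent to `Sᵏ` (`pieceTHomotopyEquiv`);
  `Plumbing.pieceO` — its part over a plumbing domain — is contractible (`contractibleSpace_pieceO`);
* `Plumbing.pieceA v = ι v '' pieceT v` — the eight open pieces of `{ρ < ε} ⊆ PV`, their pairwise
  intersections (`pieceA_inter_pieceA`, empty off the edges of the tree, contractible on the
  edges) and their union;
* `mayerVietoris_iso_of_contractible` — the Mayer–Vietoris step: for open `S, T` with `S ∩ T`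
  contractible, `Hⱼ(S ∪ T) ≅ Hⱼ(S) ⊞ Hⱼ(T)` for `j ≥ 1` (Hatcher 2002, §2.2);
* **`Plumbing.isZero_singularHomology_Wc`**, **`Plumbing.singularHomology_Wc_free_finrank`** —
  `Hⱼ(M(4m); ℤ) = 0` for `0 < j ≠ k`, and `H_k(M(4m); ℤ)` is free of rank `8`
  (through the collar `M(4m) ≃ M(4m)°`, `interiorValHomotopyEquiv`); `connectedSpace_Wc`.

Everything is proved; no named facts (D-0026).

## References

* A. Kosinski, *Differential Manifolds*, Academic Press 1993, VI.(11.5), VI.12. [Kosinski1993]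
* A. Hatcher, *Algebraic Topology*, CUP 2002, §2.2 pp. 149–150 (Mayer–Vietoris), Cor. 2.11,
  Prop. 3.42. [HatcherAT2002]
-/

open scoped Manifold ContDiff Topology RealInnerProductSpace unitInterval
open Set Function Module Filter CategoryTheory CategoryTheory.Limits

noncomputable section

namespace Literature.Topology.FourManifolds

namespace Plumbing

open Literature.AlgebraicTopology.SingularHomology Literature.AlgebraicTopology.Homotopy

/-- Local notation: `𝔼 n` is the model Euclidean space `EuclideanSpace ℝ (Fin n)`. -/
local notation "𝔼 " n:arg => EuclideanSpace ℝ (Fin n)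

/-- Local notation: `𝕊 n` is the unit sphere in `EuclideanSpace ℝ (Fin (n + 1))`. -/
local notation "𝕊 " n:arg => (Metric.sphere (0 : EuclideanSpace ℝ (Fin (n + 1))) 1)

variable {k : ℕ} {c : ℝ}

/-! ### §1 Straight segments between non-antipodal unit vectors -/

section Segment

variable {E : Type*} [NormedAddCommGroup E] [InnerProductSpace ℝ E]

/-- The segment point `(1 - t) q + t p`. [folklore] -/
def segPt (p q : E) (t : ℝ) : E := (1 - t) • q + t • p

/-- `‖(1 - t) q + t p‖² = (1 - t)² + t² + 2 t (1 - t) ⟪p, q⟫` for unit `p, q`. [folklore] -/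
theorem norm_segPt_sq {p q : E} (hp : ‖p‖ = 1) (hq : ‖q‖ = 1) (t : ℝ) :
    ‖segPt p q t‖ ^ 2 = (1 - t) ^ 2 + t ^ 2 + 2 * t * (1 - t) * ⟪p, q⟫ := by
  rw [← real_inner_self_eq_norm_sq, segPt]
  have hpp : ⟪p, p⟫ = 1 := by rw [real_inner_self_eq_norm_sq, hp, one_pow]
  have hqq : ⟪q, q⟫ = 1 := by rw [real_inner_self_eq_norm_sq, hq, one_pow]
  simp only [inner_add_left, inner_add_right, real_inner_smul_left, real_inner_smul_right, hpp, hqq,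
    real_inner_comm p q]
  ring

/-- For unit `p, q` with `⟪p, q⟫ > -1` and `t ∈ [0, 1]` the segment point is nonzero; indeed
`‖segPt‖² ≥ (1 + ⟪p, q⟫)/2 · … > 0`; we record `‖segPt‖ > 0`. [folklore] -/
theorem norm_segPt_pos {p q : E} (hp : ‖p‖ = 1) (hq : ‖q‖ = 1) (h : -1 < ⟪p, q⟫) {t : ℝ}
    (ht0 : 0 ≤ t) (ht1 : t ≤ 1) : 0 < ‖segPt p q t‖ := by
  have h2 := norm_segPt_sq hp hq t
  have key : (1 - t) ^ 2 + t ^ 2 + 2 * t * (1 - t) * ⟪p, q⟫ =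
      (1 - 2 * t) ^ 2 + 2 * (t * (1 - t)) * (1 + ⟪p, q⟫) := by ring
  have htt : 0 ≤ t * (1 - t) := mul_nonneg ht0 (sub_nonneg.2 ht1)
  have hpos : 0 < ‖segPt p q t‖ ^ 2 := by
    rw [h2, key]
    by_cases ht : t = 1 / 2
    · subst ht; nlinarith
    · have hne : (1 - 2 * t) ≠ 0 := by intro h0; exact ht (by linarith)
      have : 0 < (1 - 2 * t) ^ 2 := lt_of_le_of_ne (sq_nonneg _) (Ne.symm (pow_ne_zero 2 hne))
      nlinarith
  by_contra hle
  push Not at hle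
  have h0 : ‖segPt p q t‖ = 0 := le_antisymm hle (norm_nonneg _)
  rw [h0] at hpos
  simp at hpos

/-- `‖segPt‖ ≤ 1` on `[0, 1]` (convexity of the ball). [folklore] -/
theorem norm_segPt_le_one {p q : E} (hp : ‖p‖ = 1) (hq : ‖q‖ = 1) {t : ℝ} (ht0 : 0 ≤ t) (ht1 : t ≤ 1) :
    ‖segPt p q t‖ ≤ 1 := by
  unfold segPt
  calc ‖(1 - t) • q + t • p‖ ≤ ‖(1 - t) • q‖ + ‖t • p‖ := norm_add_le _ _
    _ = (1 - t) + t := by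
        rw [norm_smul, norm_smul, hp, hq, Real.norm_eq_abs, Real.norm_eq_abs,
          abs_of_nonneg (sub_nonneg.2 ht1), abs_of_nonneg ht0]; ring
    _ = 1 := by ring

/-- The normalised segment point. [folklore] -/
def nseg (p q : E) (t : ℝ) : E := (‖segPt p q t‖)⁻¹ • segPt p q t

/-- `norm_nseg` (norm nseg). [folklore] -/
theorem norm_nseg {p q : E} (hp : ‖p‖ = 1) (hq : ‖q‖ = 1) (h : -1 < ⟪p, q⟫) {t : ℝ}
    (ht0 : 0 ≤ t) (ht1 : t ≤ 1) : ‖nseg p q t‖ = 1 := by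
  rw [nseg, norm_smul, norm_inv, norm_norm, inv_mul_cancel₀ (norm_segPt_pos hp hq h ht0 ht1).ne']

/-- `nseg_zero` (nseg zero). [folklore] -/
theorem nseg_zero {p q : E} (hq : ‖q‖ = 1) : nseg p q 0 = q := by
  simp [nseg, segPt, hq]

/-- `nseg_one` (nseg one). [folklore] -/
theorem nseg_one {p q : E} (hp : ‖p‖ = 1) : nseg p q 1 = p := by
  simp [nseg, segPt, hp]

/-- **The inner product with `p` does not decrease along the normalised segment**:
`⟪p, nseg p q t⟫ ≥ ⟪p, q⟫` (`t ∈ [0, 1]`): the numerator is `(1 - t)⟪p, q⟫ + t ≥ ⟪p, q⟫ · ‖segPt‖`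
since `‖segPt‖ ≤ 1`… precisely `⟪p, segPt⟫ = (1-t)⟪p,q⟫ + t ≥ ⟪p, q⟫ ≥ ⟪p, q⟫ ‖segPt‖` when
`⟪p, q⟫ ≥ 0`, and in general we use `⟪p, segPt⟫ - ⟪p,q⟫‖segPt‖ ≥ ⟪p,segPt⟫ - ⟪p,q⟫⁺ ≥ 0`.
We prove it for `⟪p, q⟫ ≥ 0`, which is the case needed. [folklore] -/
theorem inner_le_inner_nseg {p q : E} (hp : ‖p‖ = 1) (hq : ‖q‖ = 1) (h : 0 ≤ ⟪p, q⟫) {t : ℝ}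
    (ht0 : 0 ≤ t) (ht1 : t ≤ 1) : ⟪p, q⟫ ≤ ⟪p, nseg p q t⟫ := by
  have hpos := norm_segPt_pos hp hq (by linarith) ht0 ht1
  have hle := norm_segPt_le_one hp hq ht0 ht1
  have hpp : ⟪p, p⟫ = 1 := by rw [real_inner_self_eq_norm_sq, hp, one_pow]
  have hnum : ⟪p, segPt p q t⟫ = (1 - t) * ⟪p, q⟫ + t := by
    simp only [segPt, inner_add_right, real_inner_smul_right, hpp]; ring
  rw [nseg, real_inner_smul_right, hnum, le_inv_mul_iff₀ hpos]
  have h1 : ⟪p, q⟫ ≤ 1 := by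
    have := real_inner_le_norm p q; rw [hp, hq] at this; linarith
  nlinarith

/-- The same for another unit vector `e` in place of `p` when moving `q` towards `p = e`: we only
need the special case above. Continuity of `nseg` in all variables on the good set. [folklore] -/
theorem continuousOn_nseg :
    ContinuousOn (fun x : E × E × ℝ => nseg x.1 x.2.1 x.2.2) {x | 0 < ‖segPt x.1 x.2.1 x.2.2‖} := by
  have hseg : Continuous fun x : E × E × ℝ => segPt x.1 x.2.1 x.2.2 := by
    unfold segPt; fun_prop
  unfold nseg
  refine ContinuousOn.smul ?_ hseg.continuousOn
  exact (hseg.norm.continuousOn).inv₀ fun x hx => ne_of_gt hx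

end Segment

/-! ### §2 The fibre-shrinking homotopy and the pieces of one tube -/

/-- The shrunk fibre vector `nseg p q t`. [folklore] -/
def shrinkVec (t : ℝ) (x : Tb k c) : 𝔼 (k + 1) :=
  nseg ((x : (𝕊 k) × (𝕊 k)).1 : 𝔼 (k + 1)) ((x : (𝕊 k) × (𝕊 k)).2 : 𝔼 (k + 1)) t

/-- `shrinkVec_mem` (shrinkVec mem). [folklore] -/
theorem shrinkVec_mem (hc : IsParam c) (t : I) (x : Tb k c) :
    shrinkVec (t : ℝ) x ∈ Metric.sphere (0 : 𝔼 (k + 1)) 1 := by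
  rw [mem_sphere_zero_iff_norm]
  exact norm_nseg (norm_eq_of_mem_sphere _) (norm_eq_of_mem_sphere _)
    (lt_of_le_of_lt hc.neg_one_le (lt_fibHt_coe x)) t.2.1 t.2.2

/-- The shrunk point of `Sᵏ × Sᵏ`. [folklore] -/
def shrinkPair (hc : IsParam c) (t : I) (x : Tb k c) : (𝕊 k) × (𝕊 k) :=
  ((x : (𝕊 k) × (𝕊 k)).1, ⟨shrinkVec (t : ℝ) x, shrinkVec_mem hc t x⟩)

/-- `lt_fibHt_shrinkPair` (lt fibHt shrinkPair). [folklore] -/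
theorem lt_fibHt_shrinkPair (hc : IsParam c) (t : I) (x : Tb k c) : c < fibHt (shrinkPair hc t x) := by
  rw [fibHt_apply]
  exact lt_of_lt_of_le (lt_fibHt_coe x) (inner_le_inner_nseg (norm_eq_of_mem_sphere _) (norm_eq_of_mem_sphere _)
    (hc.nonneg.trans (lt_fibHt_coe x).le) t.2.1 t.2.2)

/-- **Fibre shrinking**: `(p, q) ↦ (p, nseg p q t)`, moving the fibre point towards the base point
along the great circle (`t ∈ [0, 1]`), as a self-map of the tube. [folklore] -/
def shrinkPt (hc : IsParam c) (t : I) (x : Tb k c) : Tb k c :=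
  ⟨shrinkPair hc t x, lt_fibHt_shrinkPair hc t x⟩

/-- `coe_shrinkPt` (coe shrinkPt). [folklore] -/
theorem coe_shrinkPt (hc : IsParam c) (t : I) (x : Tb k c) :
    ((shrinkPt hc t x : Tb k c) : (𝕊 k) × (𝕊 k)) = shrinkPair hc t x := rfl

/-- `coe_shrinkPt_fst` (coe shrinkPt fst). [folklore] -/
theorem coe_shrinkPt_fst (hc : IsParam c) (t : I) (x : Tb k c) :
    ((shrinkPt hc t x : Tb k c) : (𝕊 k) × (𝕊 k)).1 = (x : (𝕊 k) × (𝕊 k)).1 := rfl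

/-- `coe_shrinkPt_snd` (coe shrinkPt snd). [folklore] -/
theorem coe_shrinkPt_snd (hc : IsParam c) (t : I) (x : Tb k c) :
    (((shrinkPt hc t x : Tb k c) : (𝕊 k) × (𝕊 k)).2 : 𝔼 (k + 1)) =
      nseg ((x : (𝕊 k) × (𝕊 k)).1 : 𝔼 (k + 1)) ((x : (𝕊 k) × (𝕊 k)).2 : 𝔼 (k + 1)) t := rfl

/-- The fibre height does not decrease under shrinking. [folklore] -/
theorem fibHt_le_fibHt_shrinkPt (hc : IsParam c) (t : I) (x : Tb k c) :
    fibHt (x : (𝕊 k) × (𝕊 k)) ≤ fibHt ((shrinkPt hc t x : Tb k c) : (𝕊 k) × (𝕊 k)) :=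
  inner_le_inner_nseg (norm_eq_of_mem_sphere _) (norm_eq_of_mem_sphere _) (hc.nonneg.trans (lt_fibHt_coe x).le) t.2.1 t.2.2

/-- The base height is unchanged under shrinking. [folklore] -/
theorem baseHt_shrinkPt (hc : IsParam c) (e : 𝕊 k) (t : I) (x : Tb k c) :
    baseHt e ((shrinkPt hc t x : Tb k c) : (𝕊 k) × (𝕊 k)) = baseHt e (x : (𝕊 k) × (𝕊 k)) := rfl

/-- `aFn_shrinkPt` (aFn shrinkPt). [folklore] -/
theorem aFn_shrinkPt (hc : IsParam c) (e : 𝕊 k) (t : I) (x : Tb k c) :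
    aFn e ((shrinkPt hc t x : Tb k c) : (𝕊 k) × (𝕊 k)) = aFn e (x : (𝕊 k) × (𝕊 k)) := rfl

/-- The squared fibre radius does not increase under shrinking. [folklore] -/
theorem bFn_shrinkPt_le (hc : IsParam c) (t : I) (x : Tb k c) :
    bFn ((shrinkPt hc t x : Tb k c) : (𝕊 k) × (𝕊 k)) ≤ bFn (x : (𝕊 k) × (𝕊 k)) := by
  have h1 := fibHt_le_fibHt_shrinkPt hc t x
  have h0 : 0 ≤ fibHt (x : (𝕊 k) × (𝕊 k)) := hc.nonneg.trans (lt_fibHt_coe x).le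
  rw [bFn, bFn]
  nlinarith

/-- Membership in a plumbing domain is unchanged under shrinking. [folklore] -/
theorem shrinkPt_mem_dom_iff (hc : IsParam c) (j : Fin 3) (t : I) (x : Tb k c) :
    ((shrinkPt hc t x : Tb k c) : (𝕊 k) × (𝕊 k)) ∈ dom k c j ↔ (x : (𝕊 k) × (𝕊 k)) ∈ dom k c j := by
  simp only [mem_dom, baseHt_shrinkPt]
  exact ⟨fun h => ⟨h.1, lt_fibHt_coe x⟩, fun h => ⟨h.1, lt_fibHt_coe (shrinkPt hc t x)⟩⟩

/-- **The size function does not increase under fibre shrinking** (`G` is monotone in `b`).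
[folklore] -/
theorem rhoHat_shrinkPt_le (hk : 2 ≤ k) (hc : IsParam c) (v : Fin 8) (t : I) (x : Tb k c) :
    rhoHat k c v ((shrinkPt hc t x : Tb k c) : (𝕊 k) × (𝕊 k)) ≤ rhoHat k c v (x : (𝕊 k) × (𝕊 k)) := by
  by_cases hzone : ∃ w, kosinskiGamma8 v w = 1 ∧ (x : (𝕊 k) × (𝕊 k)) ∈ dom k c (ecol v w)
  · obtain ⟨w, hvw, hx⟩ := hzone
    have hx' : ((shrinkPt hc t x : Tb k c) : (𝕊 k) × (𝕊 k)) ∈ dom k c (ecol v w) :=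
      (shrinkPt_mem_dom_iff hc _ t x).2 hx
    rw [rhoHat_eq_cornerFn hk hc hvw hx', rhoHat_eq_cornerFn hk hc hvw hx, aFn_shrinkPt]
    exact cornerFn_mono_snd bandSlope_pos (bFn_shrinkPt_le hc t x) (aFn_add_bFn_lt hc hx)
  · push Not at hzone
    have hzone' : ∀ w, kosinskiGamma8 v w = 1 → ((shrinkPt hc t x : Tb k c) : (𝕊 k) × (𝕊 k)) ∉ dom k c (ecol v w) :=
      fun w hw h => hzone w hw ((shrinkPt_mem_dom_iff hc _ t x).1 h)
    rw [rhoHat_eq_bFn v hzone', rhoHat_eq_bFn v hzone]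
    exact bFn_shrinkPt_le hc t x

/-- Shrinking is jointly continuous. [folklore] -/
theorem continuous_shrinkPt (hc : IsParam c) : Continuous fun p : I × Tb k c => shrinkPt hc p.1 p.2 := by
  have hgood : ∀ p : I × Tb k c, 0 < ‖segPt ((p.2 : (𝕊 k) × (𝕊 k)).1 : 𝔼 (k + 1))
      ((p.2 : (𝕊 k) × (𝕊 k)).2 : 𝔼 (k + 1)) (p.1 : ℝ)‖ := fun p => by
    have h := norm_segPt_pos (t := (p.1 : ℝ)) (norm_eq_of_mem_sphere (p.2 : (𝕊 k) × (𝕊 k)).1)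
      (norm_eq_of_mem_sphere (p.2 : (𝕊 k) × (𝕊 k)).2) (lt_of_le_of_lt hc.neg_one_le (lt_fibHt_coe p.2)) p.1.2.1 p.1.2.2
    exact h
  have hF : Continuous fun p : I × Tb k c =>
      (((p.2 : (𝕊 k) × (𝕊 k)).1 : 𝔼 (k + 1)), ((p.2 : (𝕊 k) × (𝕊 k)).2 : 𝔼 (k + 1)), (p.1 : ℝ)) := by
    fun_prop
  have hE : Continuous fun p : I × Tb k c => shrinkVec (p.1 : ℝ) p.2 := by
    have h := continuousOn_nseg.comp_continuous hF (fun p => hgood p)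
    exact h.congr (fun p => rfl)
  have hS : Continuous fun p : I × Tb k c => (⟨shrinkVec (p.1 : ℝ) p.2, shrinkVec_mem hc p.1 p.2⟩ : 𝕊 k) :=
    hE.subtype_mk (fun p => shrinkVec_mem hc p.1 p.2)
  have hP : Continuous fun p : I × Tb k c => shrinkPair hc p.1 p.2 :=
    (continuous_fst.comp (continuous_subtype_val.comp continuous_snd)).prodMk hS
  have hT : Continuous fun p : I × Tb k c => (⟨shrinkPair hc p.1 p.2, lt_fibHt_shrinkPair hc p.1 p.2⟩ : Tb k c) :=
    hP.subtype_mk (fun p => lt_fibHt_shrinkPair hc p.1 p.2)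
  exact hT

/-- `shrinkPt_zero` (shrinkPt zero). [folklore] -/
@[simp] theorem shrinkPt_zero (hc : IsParam c) (x : Tb k c) : shrinkPt hc 0 x = x := by
  apply Subtype.ext
  refine Prod.ext rfl (Subtype.ext ?_)
  exact nseg_zero (norm_eq_of_mem_sphere _)

/-- `shrinkPt_one` (shrinkPt one). [folklore] -/
theorem shrinkPt_one (hc : IsParam c) (x : Tb k c) :
    ((shrinkPt hc 1 x : Tb k c) : (𝕊 k) × (𝕊 k)) = ((x : (𝕊 k) × (𝕊 k)).1, (x : (𝕊 k) × (𝕊 k)).1) := by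
  refine Prod.ext rfl (Subtype.ext ?_)
  exact nseg_one (norm_eq_of_mem_sphere _)

/-! ### §3 The pieces of one tube: `{ρ̂ᵥ < ε} ≃ Sᵏ` and the contractible plumbing squares -/

section Pieces

variable (k c) in
/-- The piece `T_v(ε) = {ρ̂ᵥ < ε}` of the tube `N`. [cite: Kosinski1993, VI.(11.5)] -/
def pieceT (v : Fin 8) (ε : ℝ) : Set (Tb k c) := {x | rhoHat k c v (x : (𝕊 k) × (𝕊 k)) < ε}

variable (k c) in
/-- The plumbing square `O_{vw}(ε) = T_v(ε) ∩ D_{e(v,w)}` of the tube `N`. [cite: Kosinski1993, VI.12 p. 120] -/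
def pieceO (v w : Fin 8) (ε : ℝ) : Set (Tb k c) :=
  {x | (x : (𝕊 k) × (𝕊 k)) ∈ dom k c (ecol v w) ∧ rhoHat k c v (x : (𝕊 k) × (𝕊 k)) < ε}

/-- `isOpen_pieceT` (isOpen pieceT). [folklore] -/
theorem isOpen_pieceT (hc : IsParam c) (v : Fin 8) (ε : ℝ) : IsOpen (pieceT k c v ε) :=
  isOpen_lt (contMDiff_rhoTb hc v).continuous continuous_const

/-- `isOpen_pieceO` (isOpen pieceO). [folklore] -/
theorem isOpen_pieceO (hc : IsParam c) (v w : Fin 8) (ε : ℝ) : IsOpen (pieceO k c v w ε) :=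
  ((isOpen_dom c _).preimage continuous_subtype_val).inter (isOpen_pieceT hc v ε)

/-- `pieceO_subset_pieceT` (pieceO subset pieceT). [folklore] -/
theorem pieceO_subset_pieceT (v w : Fin 8) (ε : ℝ) : pieceO k c v w ε ⊆ pieceT k c v ε := fun _ hx => hx.2

/-- `shrinkPt_mem_pieceT` (shrinkPt mem pieceT). [folklore] -/
theorem shrinkPt_mem_pieceT (hk : 2 ≤ k) (hc : IsParam c) {v : Fin 8} {ε : ℝ} {x : Tb k c}
    (hx : x ∈ pieceT k c v ε) (t : I) : shrinkPt hc t x ∈ pieceT k c v ε :=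
  lt_of_le_of_lt (rhoHat_shrinkPt_le hk hc v t x) hx

/-- `shrinkPt_mem_pieceO` (shrinkPt mem pieceO). [folklore] -/
theorem shrinkPt_mem_pieceO (hk : 2 ≤ k) (hc : IsParam c) {v w : Fin 8} {ε : ℝ} {x : Tb k c}
    (hx : x ∈ pieceO k c v w ε) (t : I) : shrinkPt hc t x ∈ pieceO k c v w ε :=
  ⟨(shrinkPt_mem_dom_iff hc _ t x).2 hx.1, lt_of_le_of_lt (rhoHat_shrinkPt_le hk hc v t x) hx.2⟩

/-- The diagonal point `(p, p)` lies in every piece `T_v(ε)`, `ε > 0` (there `ρ̂ᵥ ≤ 0`). [folklore] -/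
theorem diagPt_mem_pieceT (hc : IsParam c) (v : Fin 8) {ε : ℝ} (hε : 0 < ε) (p : 𝕊 k) :
    diagPt hc.lt_one p ∈ pieceT k c v ε :=
  lt_of_le_of_lt (rhoHat_diagPt_le hc v p) hε

/-- The core sphere `p ↦ (p, p)` in the piece `T_v(ε)`. [cite: Kosinski1993, VI.(11.5)] -/
def coreIncl (hc : IsParam c) (v : Fin 8) {ε : ℝ} (hε : 0 < ε) : C(𝕊 k, ↥(pieceT k c v ε)) where
  toFun p := ⟨diagPt hc.lt_one p, diagPt_mem_pieceT hc v hε p⟩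
  continuous_toFun := by
    refine Continuous.subtype_mk (Continuous.subtype_mk ?_ _) _
    fun_prop

/-- The base projection `(p, q) ↦ p` on the piece `T_v(ε)`. [folklore] -/
def baseProj (v : Fin 8) (ε : ℝ) : C(↥(pieceT k c v ε), 𝕊 k) where
  toFun x := ((x : Tb k c) : (𝕊 k) × (𝕊 k)).1
  continuous_toFun := by fun_prop

/-- **The piece `T_v(ε)` deformation retracts onto its core sphere**: the fibre shrinking is a
homotopy from `coreIncl ∘ baseProj` to the identity. [cite: Kosinski1993, VI.(11.5)] -/
def pieceTHomotopy (hk : 2 ≤ k) (hc : IsParam c) (v : Fin 8) {ε : ℝ} (hε : 0 < ε) :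
    ContinuousMap.Homotopy ((coreIncl hc v hε).comp (baseProj v ε)) (ContinuousMap.id ↥(pieceT k c v ε)) where
  toFun p := ⟨shrinkPt hc (unitInterval.symm p.1) p.2.1, shrinkPt_mem_pieceT hk hc p.2.2 _⟩
  continuous_toFun := by
    refine Continuous.subtype_mk ?_ _
    exact (continuous_shrinkPt hc).comp
      ((unitInterval.continuous_symm.comp continuous_fst).prodMk (continuous_subtype_val.comp continuous_snd))
  map_zero_left x := by
    apply Subtype.ext
    change shrinkPt hc (unitInterval.symm 0) x.1 = diagPt hc.lt_one ((x : Tb k c) : (𝕊 k) × (𝕊 k)).1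
    rw [unitInterval.symm_zero]
    exact Subtype.ext (shrinkPt_one hc x.1)
  map_one_left x := by
    apply Subtype.ext
    change shrinkPt hc (unitInterval.symm 1) x.1 = x.1
    rw [unitInterval.symm_one, shrinkPt_zero]

/-- **`T_v(ε) ≃ₕ Sᵏ`** by the base projection (homotopy inverse: the core sphere).
[cite: Kosinski1993, VI.(11.5)] -/
def pieceTHomotopyEquiv (hk : 2 ≤ k) (hc : IsParam c) (v : Fin 8) {ε : ℝ} (hε : 0 < ε) :
    ContinuousMap.HomotopyEquiv ↥(pieceT k c v ε) (𝕊 k) where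
  toFun := baseProj v ε
  invFun := coreIncl hc v hε
  left_inv := ⟨pieceTHomotopy hk hc v hε⟩
  right_inv := ⟨ContinuousMap.Homotopy.refl _⟩

/-- `Hⱼ(T_v(ε)) ≅ Hⱼ(Sᵏ)`. [cite: HatcherAT2002, Cor. 2.11] -/
def pieceTIso (hk : 2 ≤ k) (hc : IsParam c) (v : Fin 8) {ε : ℝ} (hε : 0 < ε) (j : ℕ) :
    singularHomology ℤ ℤ ↥(pieceT k c v ε) j ≅ singularHomology ℤ ℤ (𝕊 k) j :=
  singularHomology.isoOfHomotopyEquiv ℤ ℤ (pieceTHomotopyEquiv hk hc v hε) j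

/-- `Sᵏ` is path connected (`k ≥ 1`). [folklore] -/
theorem pathConnectedSpace_sphere' (hk : 1 ≤ k) : PathConnectedSpace (𝕊 k) := by
  have h1 : 1 < Module.rank ℝ (𝔼 (k + 1)) := by
    rw [← Module.finrank_eq_rank, finrank_euclideanSpace_fin]
    exact_mod_cast (by omega : 1 < k + 1)
  exact (isPathConnected_iff_pathConnectedSpace).1 (isPathConnected_sphere h1 (0 : 𝔼 (k + 1)) zero_le_one)

/-- Every point of `T_v(ε)` is joined inside `T_v(ε)` to its core point `(p, p)` (fibre shrinking).
[folklore] -/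
theorem joinedIn_pieceT_core (hk : 2 ≤ k) (hc : IsParam c) {v : Fin 8} {ε : ℝ} {x : Tb k c}
    (hx : x ∈ pieceT k c v ε) : JoinedIn (pieceT k c v ε) x (shrinkPt hc 1 x) := by
  refine ⟨⟨⟨fun t => shrinkPt hc t x, ?_⟩, by simp, rfl⟩, fun t => shrinkPt_mem_pieceT hk hc hx t⟩
  exact (continuous_shrinkPt hc).comp (continuous_id.prodMk continuous_const)

/-- The piece `T_v(ε)` is path connected (`ε > 0`). [folklore] -/
theorem isPathConnected_pieceT (hk : 2 ≤ k) (hc : IsParam c) (v : Fin 8) {ε : ℝ} (hε : 0 < ε) :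
    IsPathConnected (pieceT k c v ε) := by
  haveI := pathConnectedSpace_sphere' (k := k) (by omega)
  have hdiag : ∀ p p' : 𝕊 k, JoinedIn (pieceT k c v ε) (diagPt hc.lt_one p) (diagPt hc.lt_one p') := by
    intro p p'
    obtain ⟨δ⟩ := PathConnectedSpace.joined (X := 𝕊 k) p p'
    refine ⟨δ.map (f := fun x : 𝕊 k => diagPt hc.lt_one x) ?_, fun t => diagPt_mem_pieceT hc v hε _⟩
    exact Continuous.subtype_mk (by fun_prop) _
  refine (isPathConnected_iff).2 ⟨⟨diagPt hc.lt_one (pole k 0), diagPt_mem_pieceT hc v hε _⟩, ?_⟩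
  intro x hx y hy
  have hx1 : shrinkPt hc 1 x = diagPt hc.lt_one ((x : (𝕊 k) × (𝕊 k)).1) := Subtype.ext (shrinkPt_one hc x)
  have hy1 : shrinkPt hc 1 y = diagPt hc.lt_one ((y : (𝕊 k) × (𝕊 k)).1) := Subtype.ext (shrinkPt_one hc y)
  have h1 := joinedIn_pieceT_core hk hc hx
  have h2 := joinedIn_pieceT_core hk hc hy
  rw [hx1] at h1; rw [hy1] at h2
  exact (h1.trans (hdiag _ _)).trans h2.symm

/-- The pole diagonal point `(e, e)` lies in the plumbing square `O_{vw}(ε)`, `ε > 0`. [folklore] -/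
theorem diagPt_pole_mem_pieceO (hc : IsParam c) (v w : Fin 8) {ε : ℝ} (hε : 0 < ε) :
    diagPt hc.lt_one (pole k (ecol v w).val) ∈ pieceO k c v w ε := by
  refine ⟨⟨?_, ?_⟩, lt_of_le_of_lt (rhoHat_diagPt_le hc v _) hε⟩
  · rw [baseHt_apply, coe_diagPt, real_inner_self_eq_norm_sq, norm_eq_of_mem_sphere]; linarith [hc.lt_one]
  · exact (diagPt hc.lt_one (pole k (ecol v w).val)).2

/-- The diagonal point `(d, d)` with `⟪d, e⟫ > c` lies in the plumbing square. [folklore] -/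
theorem diagPt_mem_pieceO (hc : IsParam c) (v w : Fin 8) {ε : ℝ} (hε : 0 < ε) {d : 𝕊 k}
    (hd : c < ⟪(d : 𝔼 (k + 1)), (pole k (ecol v w).val : 𝔼 (k + 1))⟫) :
    diagPt hc.lt_one d ∈ pieceO k c v w ε :=
  ⟨⟨hd, (diagPt hc.lt_one d).2⟩, lt_of_le_of_lt (rhoHat_diagPt_le hc v _) hε⟩

/-- **The plumbing square `O_{vw}(ε)` is contractible** (`ε > 0`): shrink the fibres onto the
core, then slide the core point to the pole along the diagonal. [cite: Kosinski1993, VI.12 p. 120] -/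
theorem contractibleSpace_pieceO (hk : 2 ≤ k) (hc : IsParam c) (v w : Fin 8) {ε : ℝ} (hε : 0 < ε) :
    ContractibleSpace ↥(pieceO k c v w ε) := by
  set e : 𝕊 k := pole k (ecol v w).val with he
  set O := pieceO k c v w ε with hO
  -- stage 1: fibre shrinking, from `id` to the core map
  let f₁ : C(↥O, ↥O) := ⟨fun x => ⟨shrinkPt hc 1 x.1, shrinkPt_mem_pieceO hk hc x.2 1⟩, by
    refine Continuous.subtype_mk ?_ _
    exact (continuous_shrinkPt hc).comp (continuous_const.prodMk continuous_subtype_val)⟩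
  have H₁ : ContinuousMap.Homotopy (ContinuousMap.id ↥O) f₁ :=
    { toFun := fun p => ⟨shrinkPt hc p.1 p.2.1, shrinkPt_mem_pieceO hk hc p.2.2 _⟩
      continuous_toFun := by
        refine Continuous.subtype_mk ?_ _
        exact (continuous_shrinkPt hc).comp (continuous_fst.prodMk (continuous_subtype_val.comp continuous_snd))
      map_zero_left := fun x => by apply Subtype.ext; change shrinkPt hc 0 x.1 = x.1; rw [shrinkPt_zero]
      map_one_left := fun x => rfl }
  -- stage 2: slide the base point to the pole along the diagonal
  have hbase : ∀ x : ↥O, 0 ≤ ⟪(e : 𝔼 (k + 1)), (((x : Tb k c) : (𝕊 k) × (𝕊 k)).1 : 𝔼 (k + 1))⟫ := by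
    intro x
    have h := x.2.1.1
    rw [baseHt_apply, real_inner_comm] at h
    exact hc.nonneg.trans h.le
  have hpos : ∀ p : I × ↥O, 0 < ‖segPt (e : 𝔼 (k + 1)) ((((p.2 : Tb k c)) : (𝕊 k) × (𝕊 k)).1 : 𝔼 (k + 1)) (p.1 : ℝ)‖ :=
    fun p => norm_segPt_pos (norm_eq_of_mem_sphere _) (norm_eq_of_mem_sphere _) (by linarith [hbase p.2]) p.1.2.1 p.1.2.2
  let slideVec : I × ↥O → 𝔼 (k + 1) := fun p =>
    nseg (e : 𝔼 (k + 1)) ((((p.2 : Tb k c)) : (𝕊 k) × (𝕊 k)).1 : 𝔼 (k + 1)) (p.1 : ℝ)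
  have hslide_cont : Continuous slideVec := by
    have hF : Continuous fun p : I × ↥O =>
        ((e : 𝔼 (k + 1)), ((((p.2 : Tb k c)) : (𝕊 k) × (𝕊 k)).1 : 𝔼 (k + 1)), (p.1 : ℝ)) := by fun_prop
    have h := continuousOn_nseg.comp_continuous hF (fun p => hpos p)
    exact h.congr (fun p => rfl)
  have hslide_mem : ∀ p : I × ↥O, slideVec p ∈ Metric.sphere (0 : 𝔼 (k + 1)) 1 := fun p => by
    rw [mem_sphere_zero_iff_norm]
    exact norm_nseg (norm_eq_of_mem_sphere _) (norm_eq_of_mem_sphere _) (by linarith [hbase p.2]) p.1.2.1 p.1.2.2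
  have hslide_dom : ∀ p : I × ↥O, c < ⟪slideVec p, (e : 𝔼 (k + 1))⟫ := by
    intro p
    have h := p.2.2.1.1
    rw [baseHt_apply] at h
    rw [real_inner_comm]
    exact lt_of_lt_of_le (by rw [real_inner_comm]; exact h)
      (inner_le_inner_nseg (norm_eq_of_mem_sphere _) (norm_eq_of_mem_sphere _) (hbase p.2) p.1.2.1 p.1.2.2)
  let slidePt : I × ↥O → ↥O := fun p =>
    ⟨diagPt hc.lt_one ⟨slideVec p, hslide_mem p⟩, diagPt_mem_pieceO hc v w hε (hslide_dom p)⟩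
  have hslidePt_cont : Continuous slidePt := by
    refine Continuous.subtype_mk (Continuous.subtype_mk ?_ _) _
    exact (hslide_cont.subtype_mk _).prodMk (hslide_cont.subtype_mk _)
  let x₀ : ↥O := ⟨diagPt hc.lt_one e, diagPt_pole_mem_pieceO hc v w hε⟩
  have H₂ : ContinuousMap.Homotopy f₁ (ContinuousMap.const ↥O x₀) :=
    { toFun := slidePt
      continuous_toFun := hslidePt_cont
      map_zero_left := fun x => by
        apply Subtype.ext
        change diagPt hc.lt_one ⟨slideVec (0, x), _⟩ = shrinkPt hc 1 x.1
        apply Subtype.ext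
        rw [coe_diagPt, shrinkPt_one]
        have h0 : slideVec (0, x) = ((((x : Tb k c)) : (𝕊 k) × (𝕊 k)).1 : 𝔼 (k + 1)) :=
          nseg_zero (norm_eq_of_mem_sphere _)
        refine Prod.ext (Subtype.ext h0) (Subtype.ext h0)
      map_one_left := fun x => by
        apply Subtype.ext
        change diagPt hc.lt_one ⟨slideVec (1, x), _⟩ = diagPt hc.lt_one e
        apply Subtype.ext
        rw [coe_diagPt, coe_diagPt]
        have h1 : slideVec (1, x) = (e : 𝔼 (k + 1)) := nseg_one (norm_eq_of_mem_sphere _)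
        refine Prod.ext (Subtype.ext h1) (Subtype.ext h1) }
  exact (contractible_iff_id_nullhomotopic _).2 ⟨x₀, ⟨H₁.trans H₂⟩⟩

/-- `Hⱼ(O_{vw}(ε)) = 0` for `j ≠ 0`. [cite: HatcherAT2002, Prop. 2.8] -/
theorem isZero_singularHomology_pieceO (hk : 2 ≤ k) (hc : IsParam c) (v w : Fin 8) {ε : ℝ} (hε : 0 < ε)
    {j : ℕ} (hj : j ≠ 0) : IsZero (singularHomology ℤ ℤ ↥(pieceO k c v w ε) j) :=
  haveI := contractibleSpace_pieceO hk hc v w hε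
  isZero_singularHomology_of_contractibleSpace ℤ ℤ hj

end Pieces


/-! ### §4 The eight open pieces of `{ρ < ε} ⊆ PV` and their intersections -/

section PiecesPV

variable {n : ℕ} (hk : 2 ≤ k) (hc : IsParam c) (hkn : k + k = n + 1)

/-- **The `v`-th open piece** `A_v(ε) = ι_v(T_v(ε))` of the plumbing. [cite: Kosinski1993, VI.(11.5), VI.12] -/
def pieceA (v : Fin 8) (ε : ℝ) : Set (PV k c hk hc hkn) := ι hk hc hkn v '' pieceT k c v ε

/-- `isOpen_pieceA` (isOpen pieceA). [folklore] -/
theorem isOpen_pieceA (v : Fin 8) (ε : ℝ) : IsOpen (pieceA hk hc hkn v ε) :=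
  isOpenMap_ι hk hc hkn v _ (isOpen_pieceT hc v ε)

/-- `pieceA_subset_range` (pieceA subset range). [folklore] -/
theorem pieceA_subset_range (v : Fin 8) (ε : ℝ) : pieceA hk hc hkn v ε ⊆ range (ι hk hc hkn v) :=
  image_subset_range _ _

/-- `A_v(ε) ≃ₜ T_v(ε)` (restriction of the open embedding `ι v`). [folklore] -/
def pieceAHomeomorph (v : Fin 8) (ε : ℝ) : ↥(pieceT k c v ε) ≃ₜ ↥(pieceA hk hc hkn v ε) :=
  ((isOpenEmbedding_ι hk hc hkn v).isEmbedding.comp Topology.IsEmbedding.subtypeVal).toHomeomorph.trans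
    (Homeomorph.setCongr (by rw [range_comp, Subtype.range_val]; rfl))

/-- Points of `{ρ < ε}` lie in some piece. [folklore] -/
theorem exists_mem_pieceA_of_rho_lt {ε : ℝ} {p : PV k c hk hc hkn} (hp : rho hk hc hkn p < ε) :
    ∃ v, p ∈ pieceA hk hc hkn v ε := by
  obtain ⟨v, x, rfl⟩ := exists_ι_eq hk hc hkn p
  rw [rho_ι] at hp
  exact ⟨v, x, hp, rfl⟩

/-- `rho_lt_of_mem_pieceA` (rho lt of mem pieceA). [folklore] -/
theorem rho_lt_of_mem_pieceA {ε : ℝ} {v : Fin 8} {p : PV k c hk hc hkn} (hp : p ∈ pieceA hk hc hkn v ε) :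
    rho hk hc hkn p < ε := by
  obtain ⟨x, hx, rfl⟩ := hp
  rw [rho_ι]; exact hx

/-- **The pieces cover `{ρ < ε}`.** [folklore] -/
theorem iUnion_pieceA (ε : ℝ) : ⋃ v, pieceA hk hc hkn v ε = {p | rho hk hc hkn p < ε} := by
  ext p
  simp only [mem_iUnion, mem_setOf_eq]
  exact ⟨fun ⟨v, hv⟩ => rho_lt_of_mem_pieceA hk hc hkn hv, fun hp => exists_mem_pieceA_of_rho_lt hk hc hkn hp⟩

/-- **Non-adjacent pieces are disjoint.** [cite: Kosinski1993, VI.12 p. 122] -/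
theorem pieceA_inter_pieceA_of_ne_one {v w : Fin 8} (hvw : v ≠ w) (h : kosinskiGamma8 v w ≠ 1) (ε : ℝ) :
    pieceA hk hc hkn v ε ∩ pieceA hk hc hkn w ε = ∅ :=
  Set.disjoint_iff_inter_eq_empty.1 ((disjoint_range_ι hk hc hkn hvw h).mono (pieceA_subset_range hk hc hkn v ε)
    (pieceA_subset_range hk hc hkn w ε))

/-- **Adjacent pieces meet in the plumbing square**: `A_v ∩ A_w = ι_v(O_{vw})` for an edge `{v, w}`.
[cite: Kosinski1993, VI.12 p. 120] -/
theorem pieceA_inter_pieceA_of_eq_one {v w : Fin 8} (hvw : kosinskiGamma8 v w = 1) (ε : ℝ) :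
    pieceA hk hc hkn v ε ∩ pieceA hk hc hkn w ε = ι hk hc hkn v '' pieceO k c v w ε := by
  have hne : v ≠ w := by rintro rfl; rw [kosinskiGamma8_diag] at hvw; norm_num at hvw
  ext p
  constructor
  · rintro ⟨⟨x, hx, rfl⟩, ⟨y, hy, hxy⟩⟩
    rcases (ι_eq_ι_iff hk hc hkn).1 hxy.symm with ⟨h1, -⟩ | ⟨-, hxd, rfl⟩
    · exact absurd h1 hne
    · refine ⟨x, ⟨hxd, hx⟩, rfl⟩
  · rintro ⟨x, ⟨hxd, hx⟩, rfl⟩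
    refine ⟨⟨x, hx, rfl⟩, ⟨pm hc (ecol v w) x, ?_, ι_pm hk hc hkn v w hvw hxd⟩⟩
    change rhoHat k c w (pm hc (ecol v w) x : (𝕊 k) × (𝕊 k)) < ε
    rw [coe_pm_of_mem hc hxd, rhoHat_plumbMap hk hc hvw hxd]
    exact hx

/-- `A_v ∩ A_w ≃ₜ O_{vw}` for an edge. [folklore] -/
def interHomeomorph {v w : Fin 8} (hvw : kosinskiGamma8 v w = 1) (ε : ℝ) :
    ↥(pieceO k c v w ε) ≃ₜ ↥(pieceA hk hc hkn v ε ∩ pieceA hk hc hkn w ε) :=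
  ((isOpenEmbedding_ι hk hc hkn v).isEmbedding.comp Topology.IsEmbedding.subtypeVal).toHomeomorph.trans
    (Homeomorph.setCongr (by rw [range_comp, Subtype.range_val, pieceA_inter_pieceA_of_eq_one hk hc hkn hvw]))

/-- For an edge, `A_v ∩ A_w` is contractible. [cite: Kosinski1993, VI.12 p. 120] -/
theorem contractibleSpace_inter {v w : Fin 8} (hvw : kosinskiGamma8 v w = 1) {ε : ℝ} (hε : 0 < ε) :
    ContractibleSpace ↥(pieceA hk hc hkn v ε ∩ pieceA hk hc hkn w ε) :=
  haveI := contractibleSpace_pieceO hk hc v w hε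
  (interHomeomorph hk hc hkn hvw ε).symm.contractibleSpace

/-- `Hⱼ(A_v(ε)) ≅ Hⱼ(Sᵏ)`. [cite: HatcherAT2002, Cor. 2.11] -/
def pieceAIso (v : Fin 8) {ε : ℝ} (hε : 0 < ε) (j : ℕ) :
    singularHomology ℤ ℤ ↥(pieceA hk hc hkn v ε) j ≅ singularHomology ℤ ℤ (𝕊 k) j :=
  (singularHomology.mapIso ℤ ℤ (pieceAHomeomorph hk hc hkn v ε) j).symm ≪≫ pieceTIso hk hc v hε j

/-- The pieces are path connected. [folklore] -/
theorem isPathConnected_pieceA (v : Fin 8) {ε : ℝ} (hε : 0 < ε) : IsPathConnected (pieceA hk hc hkn v ε) :=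
  (isPathConnected_pieceT hk hc v hε).image' (continuous_ι hk hc hkn v).continuousOn

end PiecesPV

/-! ### §5 The Mayer–Vietoris step: gluing along a contractible overlap -/

section MVStep

variable {Y : Type} [TopologicalSpace Y]

/-- The trace of `S` on `S ∪ T` is homeomorphic to `S`. [folklore] -/
def preimageValUnionLeft (S T : Set Y) : ↥(Subtype.val ⁻¹' S : Set ↥(S ∪ T)) ≃ₜ ↥S :=
  (preimageValHomeomorph (S ∪ T) S).trans (Homeomorph.setCongr (Set.union_inter_cancel_left))

/-- The trace of `T` on `S ∪ T` is homeomorphic to `T`. [folklore] -/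
def preimageValUnionRight (S T : Set Y) : ↥(Subtype.val ⁻¹' T : Set ↥(S ∪ T)) ≃ₜ ↥T :=
  (preimageValHomeomorph (S ∪ T) T).trans (Homeomorph.setCongr (Set.union_inter_cancel_right))

/-- The trace of `S ∩ T` on `S ∪ T` is homeomorphic to `S ∩ T`. [folklore] -/
def preimageValUnionInter (S T : Set Y) :
    ↥((Subtype.val ⁻¹' S : Set ↥(S ∪ T)) ∩ (Subtype.val ⁻¹' T : Set ↥(S ∪ T))) ≃ₜ ↥(S ∩ T) :=
  (Homeomorph.setCongr (by rw [← preimage_inter])).trans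
    ((preimageValHomeomorph (S ∪ T) (S ∩ T)).trans (Homeomorph.setCongr (by
      rw [Set.inter_eq_right]; exact inter_subset_left.trans subset_union_left)))

/-- **The Mayer–Vietoris step of the tree induction.** If `Z = U ∪ V` with `U, V` open and
`U ∩ V` contractible, then `ψ : Hⱼ(U) ⊞ Hⱼ(V) ⟶ Hⱼ(Z)` is an isomorphism for `j ≥ 1`: `φⱼ = 0`
and `φ₀` is a monomorphism (the overlap being contractible), so `ψⱼ` is into and, `δⱼ₋₁`
vanishing, onto (Hatcher 2002, §2.2 pp. 149–150). [cite: HatcherAT2002, §2.2 pp. 149–150] -/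
theorem isIso_mayerVietoris_ψ_of_contractible {Z : Type} [TopologicalSpace Z] {U V : Set Z}
    (hU : IsOpen U) (hV : IsOpen V) (hcov : U ∪ V = univ) [hct : ContractibleSpace ↥(U ∩ V)] {j : ℕ} (hj : 1 ≤ j) :
    IsIso (mayerVietoris.ψ ℤ ℤ U V j) := by
  have hUV : interior U ∪ interior V = univ := by rw [hU.interior_eq, hV.interior_eq, hcov]
  have hexc := relativeSingularHomology.isIso_map_of_interior_union_interior_holds ℤ ℤ Z
  -- `ψⱼ` is into: `φⱼ = 0`
  have hφ0 : mayerVietoris.φ ℤ ℤ U V j = 0 :=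
    (isZero_singularHomology_of_contractibleSpace ℤ ℤ (X := ↥(U ∩ V)) (by omega)).eq_of_src _ _
  haveI hmono : Mono (mayerVietoris.ψ ℤ ℤ U V j) := (mayerVietoris.exact₁_holds ℤ ℤ U V hUV j).mono_g hφ0
  -- `ψⱼ` is onto: `δⱼ₋₁ = 0`
  obtain ⟨i, rfl⟩ : ∃ i, j = i + 1 := ⟨j - 1, by omega⟩
  have hδ : mayerVietoris.δ ℤ ℤ U V hexc hUV i = 0 := by
    rcases Nat.eq_zero_or_pos i with rfl | hi
    · -- `φ₀` is into: its first component `H₀(U ∩ V) → H₀(U)` is, the overlap being path connected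
      haveI : IsIso (singularHomology.ε ℤ ℤ ↥(U ∩ V)) := singularHomology.isIso_ε_of_contractibleSpace ℤ ℤ
      have hfac : mayerVietoris.φ ℤ ℤ U V 0 ≫ biprod.fst ≫ singularHomology.ε ℤ ℤ ↥U =
          singularHomology.ε ℤ ℤ ↥(U ∩ V) := by
        rw [mayerVietoris.φ, biprod.lift_fst_assoc, singularHomology.map_ε]
      haveI : Mono (mayerVietoris.φ ℤ ℤ U V 0 ≫ biprod.fst ≫ singularHomology.ε ℤ ℤ ↥U) := by
        rw [hfac]; infer_instance
      haveI : Mono (mayerVietoris.φ ℤ ℤ U V 0) := mono_of_mono _ (biprod.fst ≫ singularHomology.ε ℤ ℤ ↥U)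
      exact (cancel_mono (mayerVietoris.φ ℤ ℤ U V 0)).1
        ((mayerVietoris.δ_comp_φ ℤ ℤ U V hexc hUV 0).trans (zero_comp).symm)
    · exact (isZero_singularHomology_of_contractibleSpace ℤ ℤ (X := ↥(U ∩ V)) (by omega)).eq_of_tgt _ _
  haveI hepi : Epi (mayerVietoris.ψ ℤ ℤ U V (i + 1)) := (mayerVietoris.exact₂_holds ℤ ℤ U V hexc hUV i).epi_f hδ
  exact isIso_of_mono_of_epi _

/-- **`Hⱼ(S ∪ T) ≅ Hⱼ(S) ⊞ Hⱼ(T)`** for open `S, T ⊆ Y` with contractible `S ∩ T`, `j ≥ 1`.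
[cite: HatcherAT2002, §2.2 pp. 149–150] -/
def mayerVietorisIsoOfContractible {S T : Set Y} (hS : IsOpen S) (hT : IsOpen T)
    [ContractibleSpace ↥(S ∩ T)] {j : ℕ} (hj : 1 ≤ j) :
    singularHomology ℤ ℤ ↥S j ⊞ singularHomology ℤ ℤ ↥T j ≅ singularHomology ℤ ℤ ↥(S ∪ T) j := by
  have hct : ContractibleSpace ↥((Subtype.val ⁻¹' S : Set ↥(S ∪ T)) ∩ (Subtype.val ⁻¹' T : Set ↥(S ∪ T))) :=
    (preimageValUnionInter S T).contractibleSpace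
  haveI : IsIso (mayerVietoris.ψ ℤ ℤ (Subtype.val ⁻¹' S : Set ↥(S ∪ T)) (Subtype.val ⁻¹' T : Set ↥(S ∪ T)) j) :=
    @isIso_mayerVietoris_ψ_of_contractible ↥(S ∪ T) _ (Subtype.val ⁻¹' S) (Subtype.val ⁻¹' T)
      (hS.preimage continuous_subtype_val) (hT.preimage continuous_subtype_val)
      (by ext x; simp only [mem_union, mem_preimage, mem_univ, iff_true]; exact x.2) hct j hj
  exact (biprod.mapIso (singularHomology.mapIso ℤ ℤ (preimageValUnionLeft S T) j)
      (singularHomology.mapIso ℤ ℤ (preimageValUnionRight S T) j)).symm ≪≫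
    asIso (mayerVietoris.ψ ℤ ℤ (Subtype.val ⁻¹' S : Set ↥(S ∪ T)) (Subtype.val ⁻¹' T : Set ↥(S ∪ T)) j)

end MVStep

/-! ### §6 Mayer–Vietoris along the `E₈` tree -/

section Tree

/-- The parent of a vertex in the `E₈` tree rooted at `Σ₁` (Kosinski's numbering): `Σ_{v}` for
`Σ_{v+1}` along the long path, and `Σ₅` for `Σ₈`. [cite: Kosinski1993, VI.12 p. 122] -/
def par (v : Fin 8) : Fin 8 := if v = 7 then 4 else ⟨v.val - 1, by omega⟩

/-- `par_lt` (par lt). [folklore] -/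
theorem par_lt : ∀ v : Fin 8, v ≠ 0 → par v < v := by decide

/-- `gamma8_par` (gamma8 par). [folklore] -/
theorem gamma8_par : ∀ v : Fin 8, v ≠ 0 → kosinskiGamma8 (par v) v = 1 := by decide

/-- The parent is the only earlier neighbour. [cite: Kosinski1993, VI.12 p. 122] -/
theorem gamma8_ne_one_of_lt : ∀ u v : Fin 8, u < v → u ≠ par v → kosinskiGamma8 u v ≠ 1 := by decide

variable {n : ℕ} (hk : 2 ≤ k) (hc : IsParam c) (hkn : k + k = n + 1)

/-- The union `X_i = A_0 ∪ ⋯ ∪ A_i` of the first `i + 1` pieces. [folklore] -/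
def unionX (i : ℕ) (ε : ℝ) : Set (PV k c hk hc hkn) := ⋃ v ∈ {v : Fin 8 | v.val ≤ i}, pieceA hk hc hkn v ε

/-- `isOpen_unionX` (isOpen unionX). [folklore] -/
theorem isOpen_unionX (i : ℕ) (ε : ℝ) : IsOpen (unionX hk hc hkn i ε) :=
  isOpen_biUnion fun v _ => isOpen_pieceA hk hc hkn v ε

/-- `unionX_zero` (unionX zero). [folklore] -/
theorem unionX_zero (ε : ℝ) : unionX hk hc hkn 0 ε = pieceA hk hc hkn 0 ε := by
  ext p
  simp only [unionX, mem_iUnion, mem_setOf_eq, exists_prop]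
  constructor
  · rintro ⟨v, hv, hp⟩
    have : v = 0 := Fin.ext (by omega)
    subst this; exact hp
  · intro hp; exact ⟨0, le_rfl, hp⟩

/-- `unionX_succ` (unionX succ). [folklore] -/
theorem unionX_succ {i : ℕ} (hi : i + 1 < 8) (ε : ℝ) :
    unionX hk hc hkn (i + 1) ε = unionX hk hc hkn i ε ∪ pieceA hk hc hkn ⟨i + 1, hi⟩ ε := by
  ext p
  simp only [unionX, mem_iUnion, mem_setOf_eq, exists_prop, mem_union]
  constructor
  · rintro ⟨v, hv, hp⟩
    rcases Nat.lt_or_ge v.val (i + 1) with h | h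
    · exact Or.inl ⟨v, by omega, hp⟩
    · have : v = ⟨i + 1, hi⟩ := Fin.ext (by simp; omega)
      subst this; exact Or.inr hp
  · rintro (⟨v, hv, hp⟩ | hp)
    · exact ⟨v, by omega, hp⟩
    · exact ⟨⟨i + 1, hi⟩, le_rfl, hp⟩

/-- `unionX_seven` (unionX seven). [folklore] -/
theorem unionX_seven (ε : ℝ) : unionX hk hc hkn 7 ε = {p | rho hk hc hkn p < ε} := by
  rw [← iUnion_pieceA hk hc hkn ε, unionX]
  ext p
  simp only [mem_iUnion, mem_setOf_eq, exists_prop]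
  exact ⟨fun ⟨v, _, hp⟩ => ⟨v, hp⟩, fun ⟨v, hp⟩ => ⟨v, by omega, hp⟩⟩

/-- `X_i ∩ A_{i+1} = A_{par(i+1)} ∩ A_{i+1}`. [cite: Kosinski1993, VI.12 p. 122] -/
theorem unionX_inter_pieceA {i : ℕ} (hi : i + 1 < 8) (ε : ℝ) :
    unionX hk hc hkn i ε ∩ pieceA hk hc hkn ⟨i + 1, hi⟩ ε =
      pieceA hk hc hkn (par ⟨i + 1, hi⟩) ε ∩ pieceA hk hc hkn ⟨i + 1, hi⟩ ε := by
  have h0 : (⟨i + 1, hi⟩ : Fin 8) ≠ 0 := by simp [Fin.ext_iff]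
  ext p
  simp only [unionX, mem_inter_iff, mem_iUnion, mem_setOf_eq, exists_prop]
  constructor
  · rintro ⟨⟨u, hu, hpu⟩, hp⟩
    refine ⟨?_, hp⟩
    by_cases hpar : u = par ⟨i + 1, hi⟩
    · rw [← hpar]; exact hpu
    · have hlt : u < ⟨i + 1, hi⟩ := Fin.lt_def.2 (by simp; omega)
      have hne : u ≠ ⟨i + 1, hi⟩ := ne_of_lt hlt
      have := pieceA_inter_pieceA_of_ne_one hk hc hkn hne (gamma8_ne_one_of_lt u _ hlt hpar) ε
      exact absurd (show p ∈ pieceA hk hc hkn u ε ∩ pieceA hk hc hkn ⟨i + 1, hi⟩ ε from ⟨hpu, hp⟩)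
        (by rw [this]; exact notMem_empty p)
  · rintro ⟨hpar, hp⟩
    exact ⟨⟨par ⟨i + 1, hi⟩, by have := par_lt ⟨i + 1, hi⟩ h0; exact Nat.le_of_lt_succ (Fin.lt_def.1 this), hpar⟩, hp⟩

/-- `Hₖ(Sᵏ; ℤ)` is free of rank one (`Hₖ(Sᵏ; ℤ) ≅ ℤ`, Hatcher Cor. 2.14; tree theorem
`nonempty_singularHomology_sphere_iso_holds`). [cite: HatcherAT2002, Cor. 2.14] -/
theorem free_finrank_sphere (hk : 1 ≤ k) :
    Module.Free ℤ (singularHomology ℤ ℤ (𝕊 k) k) ∧ Module.Finite ℤ (singularHomology ℤ ℤ (𝕊 k) k) ∧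
      Module.finrank ℤ (singularHomology ℤ ℤ (𝕊 k) k) = 1 := by
  obtain ⟨e⟩ := nonempty_singularHomology_sphere_iso_holds ℤ ℤ (n := k) hk
  let e' := e.toLinearEquiv
  refine ⟨Module.Free.of_equiv e'.symm, Module.Finite.equiv e'.symm, ?_⟩
  rw [e'.finrank_eq]
  change Module.finrank ℤ (ULift ℤ) = 1
  rw [ULift.moduleEquiv.finrank_eq, Module.finrank_self]

attribute [-instance] AddCommGroup.toIntModule in
/-- Transport of freeness and rank across an isomorphism with a biproduct (the `ℤ`-module
structures are those of the objects of `ModuleCat ℤ`). [folklore] -/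
theorem free_finrank_of_iso_biprod {A B C : ModuleCat.{0} ℤ} (e : A ⊞ B ≅ C)
    [Module.Free ℤ A] [Module.Free ℤ B] [Module.Finite ℤ A] [Module.Finite ℤ B] :
    Module.Free ℤ C ∧ Module.Finite ℤ C ∧ Module.finrank ℤ C = Module.finrank ℤ A + Module.finrank ℤ B := by
  let e' := ((ModuleCat.biprodIsoProd A B).symm ≪≫ e).toLinearEquiv
  refine ⟨Module.Free.of_equiv e', Module.Finite.equiv e', ?_⟩
  rw [← e'.finrank_eq]
  exact Module.finrank_prod

/-- **The tree induction**: for `0 < ε` and every `i < 8`, `Hⱼ(X_i; ℤ) = 0` for `0 < j ≠ k`, and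
`Hₖ(X_i; ℤ)` is free of rank `i + 1`. [cite: Kosinski1993, VI.(11.5)] [cite: HatcherAT2002, §2.2 pp. 149–150] -/
theorem homology_unionX {ε : ℝ} (hε : 0 < ε) :
    ∀ i : ℕ, i < 8 →
      (∀ j, j ≠ 0 → j ≠ k → IsZero (singularHomology ℤ ℤ ↥(unionX hk hc hkn i ε) j)) ∧
      Module.Free ℤ (singularHomology ℤ ℤ ↥(unionX hk hc hkn i ε) k) ∧
      Module.Finite ℤ (singularHomology ℤ ℤ ↥(unionX hk hc hkn i ε) k) ∧
      Module.finrank ℤ (singularHomology ℤ ℤ ↥(unionX hk hc hkn i ε) k) = i + 1 := by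
  obtain ⟨hSfree, hSfin, hSrank⟩ := free_finrank_sphere (k := k) (by omega)
  haveI := hSfree
  haveI := hSfin
  have hk0 : k ≠ 0 := by omega
  -- the pieces
  have hA : ∀ (v : Fin 8) (j : ℕ), j ≠ 0 → j ≠ k → IsZero (singularHomology ℤ ℤ ↥(pieceA hk hc hkn v ε) j) :=
    fun v j hj hjk => (SphereProd.isZero_singularHomology_sphere hj hjk).of_iso (pieceAIso hk hc hkn v hε j)
  have hAk : ∀ v : Fin 8, Module.Free ℤ (singularHomology ℤ ℤ ↥(pieceA hk hc hkn v ε) k) ∧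
      Module.Finite ℤ (singularHomology ℤ ℤ ↥(pieceA hk hc hkn v ε) k) ∧
      Module.finrank ℤ (singularHomology ℤ ℤ ↥(pieceA hk hc hkn v ε) k) = 1 := by
    intro v
    let e := (pieceAIso hk hc hkn v hε k).toLinearEquiv
    exact ⟨Module.Free.of_equiv e.symm, Module.Finite.equiv e.symm, by rw [e.finrank_eq, hSrank]⟩
  intro i
  induction i with
  | zero =>
    intro _
    rw [unionX_zero]
    exact ⟨hA 0, hAk 0⟩
  | succ i ih =>
    intro hi
    obtain ⟨ihZ, ihF, ihFin, ihR⟩ := ih (by omega)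
    haveI := ihF; haveI := ihFin
    obtain ⟨hvF, hvFin, hvR⟩ := hAk ⟨i + 1, hi⟩
    haveI := hvF; haveI := hvFin
    have h0 : (⟨i + 1, hi⟩ : Fin 8) ≠ 0 := by simp [Fin.ext_iff]
    haveI : ContractibleSpace ↥(unionX hk hc hkn i ε ∩ pieceA hk hc hkn ⟨i + 1, hi⟩ ε) := by
      rw [unionX_inter_pieceA hk hc hkn hi]
      exact contractibleSpace_inter hk hc hkn (gamma8_par _ h0) hε
    have e : ∀ j, 1 ≤ j → (singularHomology ℤ ℤ ↥(unionX hk hc hkn i ε) j ⊞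
        singularHomology ℤ ℤ ↥(pieceA hk hc hkn ⟨i + 1, hi⟩ ε) j ≅
        singularHomology ℤ ℤ ↥(unionX hk hc hkn (i + 1) ε) j) := fun j hj => by
      rw [unionX_succ hk hc hkn hi]
      exact mayerVietorisIsoOfContractible (isOpen_unionX hk hc hkn i ε) (isOpen_pieceA hk hc hkn _ ε) hj
    refine ⟨fun j hj hjk => ?_, ?_⟩
    · have hZ : IsZero (singularHomology ℤ ℤ ↥(unionX hk hc hkn i ε) j ⊞
          singularHomology ℤ ℤ ↥(pieceA hk hc hkn ⟨i + 1, hi⟩ ε) j) :=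
        (biprod_isZero_iff _ _).2 ⟨ihZ j hj hjk, hA _ j hj hjk⟩
      exact hZ.of_iso (e j (Nat.one_le_iff_ne_zero.2 hj)).symm
    · obtain ⟨hF, hFin, hR⟩ := free_finrank_of_iso_biprod (e k (Nat.one_le_iff_ne_zero.2 hk0))
      exact ⟨hF, hFin, by rw [hR, ihR, hvR]⟩

/-- **The homology of `{ρ < ε}`**: `Hⱼ = 0` for `0 < j ≠ k`, and `Hₖ` is free of rank `8`.
[cite: Kosinski1993, VI.(11.5)] -/
theorem homology_rho_lt {ε : ℝ} (hε : 0 < ε) :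
    (∀ j, j ≠ 0 → j ≠ k → IsZero (singularHomology ℤ ℤ ↥{p : PV k c hk hc hkn | rho hk hc hkn p < ε} j)) ∧
      Module.Free ℤ (singularHomology ℤ ℤ ↥{p : PV k c hk hc hkn | rho hk hc hkn p < ε} k) ∧
      Module.Finite ℤ (singularHomology ℤ ℤ ↥{p : PV k c hk hc hkn | rho hk hc hkn p < ε} k) ∧
      Module.finrank ℤ (singularHomology ℤ ℤ ↥{p : PV k c hk hc hkn | rho hk hc hkn p < ε} k) = 8 := by
  rw [← unionX_seven hk hc hkn ε]
  exact homology_unionX hk hc hkn hε 7 (by norm_num)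

/-- `{ρ < ε}` is path connected (`ε > 0`). [folklore] -/
theorem isPathConnected_rho_lt {ε : ℝ} (hε : 0 < ε) : IsPathConnected {p : PV k c hk hc hkn | rho hk hc hkn p < ε} := by
  -- by induction along the tree: `X_{i+1} = X_i ∪ A_{i+1}` with nonempty intersection
  have key : ∀ i : ℕ, i < 8 → IsPathConnected (unionX hk hc hkn i ε) := by
    intro i
    induction i with
    | zero => intro _; rw [unionX_zero]; exact isPathConnected_pieceA hk hc hkn 0 hε
    | succ i ih =>
      intro hi
      rw [unionX_succ hk hc hkn hi]
      have h0 : (⟨i + 1, hi⟩ : Fin 8) ≠ 0 := by simp [Fin.ext_iff]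
      haveI := contractibleSpace_inter hk hc hkn (gamma8_par ⟨i + 1, hi⟩ h0) hε
      obtain ⟨p, hp⟩ := (inferInstance : Nonempty ↥(pieceA hk hc hkn (par ⟨i + 1, hi⟩) ε ∩ pieceA hk hc hkn ⟨i + 1, hi⟩ ε))
      have hpX : (p : PV k c hk hc hkn) ∈ unionX hk hc hkn i ε := by
        rw [unionX]
        exact mem_biUnion (show par ⟨i + 1, hi⟩ ∈ {v : Fin 8 | v.val ≤ i} from by
          have := par_lt ⟨i + 1, hi⟩ h0
          exact Nat.le_of_lt_succ (Fin.lt_def.1 this)) hp.1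
      exact (ih (by omega)).union (isPathConnected_pieceA hk hc hkn _ hε) ⟨p, hpX, hp.2⟩
  rw [← unionX_seven hk hc hkn ε]
  exact key 7 (by norm_num)

end Tree

/-! ### §7 The homology of the compact plumbing `M(4m)` -/

section Compact

variable {n : ℕ} (hk : 2 ≤ k) (hc : IsParam c) (hkn : k + k = n + 1) {ε : ℝ} (hε : 0 < ε) (hε' : ε ≤ epsMax c)

/-- A path-connected space homotopy equivalent to `Y` makes `Y` path connected. [folklore] -/
theorem pathConnectedSpace_of_homotopyEquiv {X Y : Type*} [TopologicalSpace X] [TopologicalSpace Y]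
    [PathConnectedSpace X] (e : ContinuousMap.HomotopyEquiv X Y) : PathConnectedSpace Y := by
  obtain ⟨H⟩ := e.right_inv
  -- every point `y` is joined to `e (e⁻¹ y)`, and these are joined through `X`
  have hjoin : ∀ y : Y, Joined (e.toFun (e.invFun y)) y := fun y =>
    ⟨{ toFun := fun t => H (t, y)
       continuous_toFun := H.continuous.comp (continuous_id.prodMk continuous_const)
       source' := by simp
       target' := by simp }⟩
  haveI : Nonempty Y := ⟨e.toFun (Classical.arbitrary X)⟩
  refine ⟨inferInstance, fun x y => ?_⟩
  obtain ⟨γ⟩ := PathConnectedSpace.joined (X := X) (e.invFun x) (e.invFun y)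
  exact ((hjoin x).symm.trans ⟨γ.map e.toFun.continuous⟩).trans (hjoin y)

/-- The only neighbour of `Σ₈` is `Σ₅`, along the edge of colour `2`. [cite: Kosinski1993, VI.12 p. 122] -/
theorem gamma8_seven_eq_one : ∀ w : Fin 8, kosinskiGamma8 7 w = 1 → w = 4 := by decide

/-- `ecol_seven_four` (ecol seven four). [folklore] -/
theorem ecol_seven_four : ecol 7 4 = 2 := by decide

/-- The boundary `∂M(4m)` embeds in `M(4m)`; it is Hausdorff, second countable and compact. [folklore] -/
theorem t2Space_bd : T2Space (Wc.bd hk hc hkn hε).carrier :=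
  (Wc.bd hk hc hkn hε).isSmoothEmbedding.isEmbedding.t2Space

/-- `secondCountableTopology_bd` (secondCountableTopology bd). [folklore] -/
theorem secondCountableTopology_bd : SecondCountableTopology (Wc.bd hk hc hkn hε).carrier :=
  (Wc.bd hk hc hkn hε).isSmoothEmbedding.isEmbedding.secondCountableTopology

include hε' in
/-- `compactSpace_bd` (compactSpace bd). [folklore] -/
theorem compactSpace_bd : CompactSpace (Wc.bd hk hc hkn hε).carrier :=
  letI := compactSpace_Wc hk hc hkn hε hε'
  BoundaryData.compactSpace_carrier _

include hε in
/-- **A boundary point**: `(e₀, √(1 - ε) e₀ + √ε e₁)` in the last tube has `ρ = b = ε`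
(it lies off every plumbing domain of `Σ₈`, whose only edge is coloured by the pole `e₂ ⊥ e₀`).
[folklore] -/
theorem exists_rho_eq (hε'' : ε < rsq c) : ∃ p : PV k c hk hc hkn, rho hk hc hkn p = ε := by
  -- the point `q = √(1-ε) e₀ + √ε e₁`
  have hk1 : 1 < k + 1 := by omega
  set e0 : 𝔼 (k + 1) := EuclideanSpace.single (⟨0, by omega⟩ : Fin (k + 1)) 1 with he0
  set e1 : 𝔼 (k + 1) := EuclideanSpace.single (⟨1, hk1⟩ : Fin (k + 1)) 1 with he1
  have h01 : ⟪e0, e1⟫ = 0 := by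
    rw [he0, he1, EuclideanSpace.inner_single_left]; simp
  have he0n : ‖e0‖ = 1 := by rw [he0]; simp
  have he1n : ‖e1‖ = 1 := by rw [he1]; simp
  have hε1 : ε < 1 := by have := hc.lt_one; have := hc.nonneg; rw [rsq] at hε''; nlinarith
  set q : 𝔼 (k + 1) := Real.sqrt (1 - ε) • e0 + Real.sqrt ε • e1 with hq
  have hqn : ‖q‖ = 1 := by
    have h : ‖q‖ ^ 2 = 1 := by
      rw [← real_inner_self_eq_norm_sq, hq]
      have h00 : ⟪e0, e0⟫ = 1 := by rw [real_inner_self_eq_norm_sq, he0n, one_pow]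
      have h11 : ⟪e1, e1⟫ = 1 := by rw [real_inner_self_eq_norm_sq, he1n, one_pow]
      have h10 : ⟪e1, e0⟫ = 0 := by rw [real_inner_comm]; exact h01
      simp only [inner_add_left, inner_add_right, real_inner_smul_left, real_inner_smul_right, h00, h11, h01, h10]
      have hs1 : Real.sqrt (1 - ε) * Real.sqrt (1 - ε) = 1 - ε := Real.mul_self_sqrt (by linarith)
      have hs2 : Real.sqrt ε * Real.sqrt ε = ε := Real.mul_self_sqrt hε.le
      nlinarith
    exact (pow_eq_one_iff_of_nonneg (norm_nonneg _) two_ne_zero).1 h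
  have hpq : ⟪e0, q⟫ = Real.sqrt (1 - ε) := by
    have h00 : ⟪e0, e0⟫ = 1 := by rw [real_inner_self_eq_norm_sq, he0n, one_pow]
    rw [hq, inner_add_right, real_inner_smul_right, real_inner_smul_right, h00, h01]; ring
  -- it lies in the tube
  have htube : c < Real.sqrt (1 - ε) := by
    rw [rsq] at hε''
    have : c ^ 2 < 1 - ε := by linarith
    calc c = Real.sqrt (c ^ 2) := (Real.sqrt_sq hc.nonneg).symm
      _ < Real.sqrt (1 - ε) := Real.sqrt_lt_sqrt (sq_nonneg _) this
  have hpole : (pole k 0 : 𝔼 (k + 1)) = e0 := coe_pole_of_lt (by omega)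
  let x : Tb k c := ⟨(pole k 0, ⟨q, by simp [hqn]⟩), by
    change c < fibHt _; rw [fibHt_apply, hpole]; exact hpq ▸ htube⟩
  refine ⟨ι hk hc hkn 7 x, ?_⟩
  rw [rho_ι]
  -- off every plumbing domain of vertex `7` (only neighbour `4`, colour `2`): `ρ̂₇ = b = ε`
  have hoff : ∀ w, kosinskiGamma8 7 w = 1 → (x : (𝕊 k) × (𝕊 k)) ∉ dom k c (ecol 7 w) := by
    intro w hw h
    obtain rfl := gamma8_seven_eq_one w hw
    rw [ecol_seven_four] at h
    have hb := h.1
    rw [baseHt_apply] at hb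
    have horth := inner_pole_pole_of_ne hk (show (0 : Fin 3) ≠ 2 by decide)
    change ⟪(pole k 0 : 𝔼 (k + 1)), (pole k 2 : 𝔼 (k + 1))⟫ = 0 at horth
    change c < ⟪(pole k 0 : 𝔼 (k + 1)), (pole k 2 : 𝔼 (k + 1))⟫ at hb
    rw [horth] at hb
    exact absurd hb (not_lt.2 hc.nonneg)
  rw [rhoHat_eq_bFn 7 hoff, bFn, fibHt_apply]
  change 1 - ⟪(pole k 0 : 𝔼 (k + 1)), q⟫ ^ 2 = ε
  rw [hpole, hpq, Real.sq_sqrt (by linarith)]; ring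

include hε' in
/-- The boundary `∂M(4m)` is nonempty. [folklore] -/
theorem nonempty_bd : Nonempty (Wc.bd hk hc hkn hε).carrier := by
  have hε'' : ε < rsq c := by have := rsq_pos hc; rw [epsMax] at hε'; linarith
  obtain ⟨p, hp⟩ := exists_rho_eq hk hc hkn hε hε''
  have hmem : (⟨p, hp.le⟩ : Wc hk hc hkn hε) ∈ (𝓡∂ (n + 1)).boundary (Wc hk hc hkn hε) :=
    (RegularSublevel.mem_boundary_iff _ _).2 hp
  rw [← (Wc.bd hk hc hkn hε).range_incl] at hmem
  obtain ⟨y, _⟩ := hmem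
  exact ⟨y⟩

/-- **The interior of `M(4m)` is `{ρ < ε}`** (homeomorphically, by the inclusion).
[cite: Milnor1963, Thm. 3.1] -/
def interiorHomeomorphRhoLt :
    InteriorManifold (𝓡∂ (n + 1)) (Wc hk hc hkn hε) ≃ₜ ↥{p : PV k c hk hc hkn | rho hk hc hkn p < ε} where
  toFun x := ⟨Wc.incl hk hc hkn hε x.val, (RegularSublevel.isInteriorPoint_iff _ x.val).1 x.property⟩
  invFun p := ⟨⟨p.1, Set.mem_preimage.2 (Set.mem_Iic.2 (le_of_lt (a := rho hk hc hkn p.1) p.2))⟩,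
    (RegularSublevel.isInteriorPoint_iff _ _).2 p.2⟩
  left_inv x := rfl
  right_inv p := rfl
  continuous_toFun := (RegularSublevel.continuous_incl _ |>.comp InteriorManifold.continuous_val).subtype_mk _
  continuous_invFun := by
    rw [continuous_induced_rng]
    exact continuous_subtype_val.subtype_mk _

/-- **The homology of the compact plumbing through its interior**: for `0 < ε ≤ ε₀`,
`Hⱼ(M(4m); ℤ) ≅ Hⱼ({ρ < ε}; ℤ)` (collar: `M(4m) ≃ M(4m)°`, Hatcher Prop. 3.42; then the interior
is `{ρ < ε}`). [cite: HatcherAT2002, Prop. 3.42] -/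
theorem nonempty_iso_singularHomology_Wc (j : ℕ) :
    Nonempty (singularHomology ℤ ℤ (Wc.nullCobordism hk hc hkn hε hε').W j ≅
      singularHomology ℤ ℤ ↥{p : PV k c hk hc hkn | rho hk hc hkn p < ε} j) := by
  obtain ⟨m, rfl⟩ : ∃ m, n = m + 1 := ⟨n - 1, by omega⟩
  haveI := t2Space_bd hk hc hkn hε
  haveI := secondCountableTopology_bd hk hc hkn hε
  haveI := compactSpace_bd hk hc hkn hε hε'
  haveI := nonempty_bd hk hc hkn hε hε'
  set cW := Wc.nullCobordism hk hc hkn hε hε' with hcW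
  obtain ⟨κ, hκ⟩ := cW.exists_boundaryCollar
  exact ⟨(singularHomology.isoOfHomotopyEquiv ℤ ℤ (cW.interiorValHomotopyEquiv hκ) j).symm ≪≫
    singularHomology.mapIso ℤ ℤ (interiorHomeomorphRhoLt hk hc hkn hε) j⟩

/-- **`Hⱼ(M(4m); ℤ) = 0` for `0 < j ≠ k`** (Kosinski VI.(11.5): `M(4m) ≃ ⋁₈ Sᵏ`).
[cite: Kosinski1993, VI.(11.5)] -/
theorem isZero_singularHomology_Wc {j : ℕ} (hj : j ≠ 0) (hjk : j ≠ k) :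
    IsZero (singularHomology ℤ ℤ (Wc.nullCobordism hk hc hkn hε hε').W j) := by
  obtain ⟨e⟩ := nonempty_iso_singularHomology_Wc hk hc hkn hε hε' j
  exact ((homology_rho_lt hk hc hkn hε).1 j hj hjk).of_iso e

/-- **`Hₖ(M(4m); ℤ)` is free of rank `8`** (Kosinski VI.(11.5)). [cite: Kosinski1993, VI.(11.5)] -/
theorem free_finrank_singularHomology_Wc :
    Module.Free ℤ (singularHomology ℤ ℤ (Wc.nullCobordism hk hc hkn hε hε').W k) ∧
      Module.Finite ℤ (singularHomology ℤ ℤ (Wc.nullCobordism hk hc hkn hε hε').W k) ∧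
      Module.finrank ℤ (singularHomology ℤ ℤ (Wc.nullCobordism hk hc hkn hε hε').W k) = 8 := by
  obtain ⟨e⟩ := nonempty_iso_singularHomology_Wc hk hc hkn hε hε' k
  obtain ⟨-, hF, hFin, hR⟩ := homology_rho_lt hk hc hkn hε
  let e' := e.toLinearEquiv
  exact ⟨Module.Free.of_equiv e'.symm, Module.Finite.equiv e'.symm, by rw [e'.finrank_eq, hR]⟩

/-- **`M(4m)` is connected** (indeed path connected: its interior `{ρ < ε}` is, and every point
is pushed into the interior along a collar). [folklore] -/
theorem connectedSpace_Wc : ConnectedSpace (Wc.nullCobordism hk hc hkn hε hε').W := by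
  obtain ⟨m, rfl⟩ : ∃ m, n = m + 1 := ⟨n - 1, by omega⟩
  haveI := t2Space_bd hk hc hkn hε
  haveI := secondCountableTopology_bd hk hc hkn hε
  haveI := compactSpace_bd hk hc hkn hε hε'
  haveI := nonempty_bd hk hc hkn hε hε'
  set cW := Wc.nullCobordism hk hc hkn hε hε' with hcW
  obtain ⟨κ, hκ⟩ := cW.exists_boundaryCollar
  haveI : PathConnectedSpace ↥{p : PV k c hk hc hkn | rho hk hc hkn p < ε} :=
    (isPathConnected_iff_pathConnectedSpace).1 (isPathConnected_rho_lt hk hc hkn hε)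
  haveI : PathConnectedSpace cW.Interior := by
    rw [pathConnectedSpace_iff_univ]
    have h := isPathConnected_range (interiorHomeomorphRhoLt hk hc hkn hε).symm.continuous
    rwa [(interiorHomeomorphRhoLt hk hc hkn hε).symm.range_coe] at h
  haveI := pathConnectedSpace_of_homotopyEquiv (cW.interiorValHomotopyEquiv hκ)
  infer_instance

end Compact

end Plumbing

end Literature.Topology.FourManifolds
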